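import Literature.NumberTheory.GaloisRepresentations.ContinuousH1
import HarnessLib

/-!
# `θ`-torsion classes of `H¹_cont(G, T)` for a scalar `θ` acting injectively on `T`
# (Greenberg 2010 §2, the exact sequence (7) and the injectivity (8)), on explicit continuous cocycles

Topic `NumberTheory/GaloisRepresentations`; namespace `Literature.NumberTheory.GaloisRepresentations`.
THEOREMS ONLY (no definition, no named fact, no `sorry`): generic continuous-cochain algebra on the
tree's `contOneCocycles` / `oneCocycleClass` / `oneCocycleClass_eq_zero_iff` / `map_oneCocycleClass`
(`ContinuousH1.lean`), for an ARBITRARY topological representation `X : TopRep R G` (no discreteness: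
the intended `X` is a compact `Λ`-adic `T* = Hom(D, μ_{p^∞})`). Seat `bsd-line-x1-p1-w5` gen 9 (cell
`bsd-eis`), brick C3 of the road memo «SUR-Λ» toward the by-name input `Greenberg2016.prop263_sur_of_crk`
of crux 2 `GoodLatticeBDPValue` (stmt-BirchSwinnertonDyer-19032).

PRINT. R. Greenberg, *Surjectivity of the global-to-local map defining a Selmer group*, Kyoto J.
Math. 50 (2010), §2.1 pp. 7–8, proof of Prop. 2.1.1: "if `θ` is a nonzero element of `Λ`, then
multiplication by `θ` gives an exact sequence `0 → T* →θ T* → T*/θT* → 0` from which we obtain the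
following exact sequence of cohomology groups (7) `H⁰(K, T*) → H⁰(K, T*/θT*) → H¹(K_Σ/K, T*)[θ] → 0`.
We have a similar exact sequence for the cohomology groups over `K_η`. However, since we are assuming
that `H⁰(K_η, T*) = 0`, it follows that `H⁰(K, T*) = 0` too. Thus … the horizontal maps in the
following commutative diagram are isomorphisms [`H⁰(K, T*/θT*) ≅ H¹(K, T*)[θ]`,
`H⁰(K_η, T*/θT*) ≅ H¹(K_η, T*)[θ]`]. The first vertical map is injective. Hence so is the second. As a
consequence, the map (8) `H¹(K, T*)_{Λ-tors} → H¹(K_η, T*)_{Λ-tors}` is injective."; §2.3 p. 13,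
proof of Prop. 2.3.2: "Just as in the proof of proposition 2.1.1, assumption (i) implies that the
first map is injective. It is the map (8)."; §2.2 p. 9, proof of Prop. 2.2.1: "We can use the exact
sequence (7). Thus, it suffices to show that `H⁰(K, T*/θT*) = 0`".

WHAT IS TYPED (cocycle level, `θ : R` any scalar; "`θ` regular on `X`" = `∀ x, θ • x = 0 → x = 0`,
which is what "`T*` torsion-free" supplies for `θ ≠ 0`):

* `exists_smul_apply_eq_sub_of_smul_oneCocycleClass_eq_zero` — **(7), the surjection
  `H⁰(G, X/θX) ↠ H¹(G, X)[θ]` read backwards**: if `θ • [φ] = 0` then `θ • φ(g) = g•t − t` for one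
  `t ∈ X` (whose class mod `θX` is then `G`-invariant); and the converse `smul_oneCocycleClass_eq_zero_of_exists`.
* `oneCocycleClass_eq_zero_of_smul_apply_eq_sub_of_mem_range` — **(7), exactness at `H⁰(G, X/θX)`**:
  if moreover `t ∈ θX + X^G`-wise… precisely if `t = θ • u` then `[φ] = 0` (`θ` regular); and the form
  `oneCocycleClass_eq_zero_of_forall_invariant_mod_mem_range` used by Prop. 2.2.1: if EVERY `x` with
  `g•x − x ∈ θX` for all `g` lies in `θX` ("`H⁰(G, X/θX) = 0`" modulo `θX`), every `θ`-torsion class dies.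
* `oneCocycleClass_eq_zero_of_smul_eq_zero_of_restrict` — **(8), injectivity on `θ`-torsion of the
  restriction along `ι : H →ₜ* G` when `X^{ι(H)} = 0`**: a class `[φ]` with `θ • [φ] = 0` whose pulled-back
  cocycle `φ ∘ ι` is principal is zero (`θ` regular). Proof as printed: `θ φ(g) = g t − t`,
  `φ(ι h) = ι h • u − u` ⇒ `ι h • (t − θu) = t − θu` ⇒ `t = θu` ⇒ `φ(g) = g u − u`.
* `eq_zero_of_smul_eq_zero_of_map_eq_zero` — the same on classes `y : continuousCohomology 1 X` with
  Mathlib's functoriality map `ContinuousCohomology.map ι (𝟙 (res ι X)) 1`.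

HONEST FRAMING: generic cocycle algebra; a helper toward the kernel discharge of Greenberg 2010
Prop. 3.2.1 (c) (= `prop263_sur_of_crk`), which this file does not prove; nothing summit-side, no
case of BSD. AI-typed, kernel-checked.

## References
* [Greenberg2010] R. Greenberg, Kyoto J. Math. 50 (2010) 853–888, doi:10.1215/0023608x-2010-016 —
  §2.1 pp. 7–8 ((7), (8), proof of Prop. 2.1.1), §2.2 p. 9 (proof of Prop. 2.2.1), §2.3 p. 13 (proof of Prop. 2.3.2).
* J.-P. Serre, *Galois Cohomology* (1997), I §5.1 (crossed homomorphisms) — the cocycle calculus.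
-/

noncomputable section

open CategoryTheory

universe u v

namespace Literature.NumberTheory.GaloisRepresentations

open TopRep ContinuousCohomology

variable {R : Type u} [CommRing R] [TopologicalSpace R]
variable {G : Type v} [Group G] [TopologicalSpace G] [IsTopologicalGroup G]
variable (X : TopRep.{v} R G)

/-! ### §1. (7): `θ`-torsion classes come from `G`-invariants of `X/θX` -/

omit [IsTopologicalGroup G] in
/-- Values of a scalar multiple of a continuous cocycle. [cite: Greenberg2010, §2.1 p. 7 (7)] -/
theorem contOneCocycles.coe_smul_apply (θ : R) (φ : contOneCocycles X) (g : G) :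
    (θ • φ).1 g = θ • φ.1 g := rfl

/-- **Greenberg 2010 (7), read backwards: a `θ`-torsion class of `H¹_cont(G, X)` is represented by a
cocycle `φ` with `θ • φ(g) = g • t − t` for one `t ∈ X`** (then `t mod θX ∈ H⁰(G, X/θX)`).
[cite: Greenberg2010, §2.1 pp. 7–8, (7) (proof of Prop. 2.1.1)] -/
theorem exists_smul_apply_eq_sub_of_smul_oneCocycleClass_eq_zero (θ : R) (φ : contOneCocycles X)
    (h : θ • oneCocycleClass X φ = 0) : ∃ t : X, ∀ g : G, θ • φ.1 g = X.ρ g t - t := by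
  rw [← oneCocycleClass_smul, oneCocycleClass_eq_zero_iff] at h
  obtain ⟨t, ht⟩ := h
  exact ⟨t, fun g => by rw [← contOneCocycles.coe_smul_apply, ht g]⟩

/-- Converse of the previous lemma: if `θ • φ(g) = g • t − t` for all `g`, then `θ • [φ] = 0`.
[cite: Greenberg2010, §2.1 pp. 7–8, (7)] -/
theorem smul_oneCocycleClass_eq_zero_of_exists (θ : R) (φ : contOneCocycles X) {t : X}
    (ht : ∀ g : G, θ • φ.1 g = X.ρ g t - t) : θ • oneCocycleClass X φ = 0 := by
  rw [← oneCocycleClass_smul, oneCocycleClass_eq_zero_iff]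
  exact ⟨t, fun g => by rw [contOneCocycles.coe_smul_apply, ht g]⟩

/-- **Greenberg 2010 (7), exactness: if the invariant `t` is itself divisible by `θ` in `X`, the
class vanishes** (`θ` acting injectively on `X`): from `θ • φ(g) = g • (θ • u) − θ • u` one gets
`φ(g) = g • u − u`. [cite: Greenberg2010, §2.1 pp. 7–8, (7) (proof of Prop. 2.1.1)] -/
theorem oneCocycleClass_eq_zero_of_smul_apply_eq_sub_smul (θ : R)
    (hθ : ∀ x : X, θ • x = 0 → x = 0) (φ : contOneCocycles X) (u : X)
    (hφ : ∀ g : G, θ • φ.1 g = X.ρ g (θ • u) - θ • u) : oneCocycleClass X φ = 0 := by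
  rw [oneCocycleClass_eq_zero_iff]
  refine ⟨u, fun g => ?_⟩
  have h : θ • (φ.1 g - (X.ρ g u - u)) = 0 := by
    rw [smul_sub, hφ g, map_smul, smul_sub, sub_self]
  exact sub_eq_zero.1 (hθ _ h)

/-- **Prop. 2.2.1's use of (7): if `H⁰(G, X/θX)` is trivial — every `x ∈ X` with `g • x − x ∈ θX`
for all `g` lies in `θX` — then every `θ`-torsion class of `H¹_cont(G, X)` vanishes** (`θ` acting
injectively on `X`). [cite: Greenberg2010, §2.2 p. 9 L40–41 (proof of Prop. 2.2.1) with §2.1 (7)] -/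
theorem oneCocycleClass_eq_zero_of_forall_invariant_mod (θ : R)
    (hθ : ∀ x : X, θ • x = 0 → x = 0)
    (hH0 : ∀ t : X, (∀ g : G, ∃ x : X, X.ρ g t - t = θ • x) → ∃ u : X, t = θ • u)
    (φ : contOneCocycles X) (h : θ • oneCocycleClass X φ = 0) : oneCocycleClass X φ = 0 := by
  obtain ⟨t, ht⟩ := exists_smul_apply_eq_sub_of_smul_oneCocycleClass_eq_zero X θ φ h
  obtain ⟨u, rfl⟩ := hH0 t fun g => ⟨φ.1 g, (ht g).symm⟩
  exact oneCocycleClass_eq_zero_of_smul_apply_eq_sub_smul X θ hθ φ u ht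

/-- Class form of the previous statement: under the same hypotheses `θ • y = 0 → y = 0` on
`H¹_cont(G, X)`. [cite: Greenberg2010, §2.2 p. 9 (proof of Prop. 2.2.1) with §2.1 (7)] -/
theorem eq_zero_of_smul_eq_zero_of_forall_invariant_mod (θ : R)
    (hθ : ∀ x : X, θ • x = 0 → x = 0)
    (hH0 : ∀ t : X, (∀ g : G, ∃ x : X, X.ρ g t - t = θ • x) → ∃ u : X, t = θ • u)
    (y : continuousCohomology 1 X) (hy : θ • y = 0) : y = 0 := by
  obtain ⟨φ, rfl⟩ := oneCocycleClass_surjective X y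
  exact oneCocycleClass_eq_zero_of_forall_invariant_mod X θ hθ hH0 φ hy

/-! ### §2. (8): restriction is injective on `θ`-torsion when the subgroup has no invariants -/

variable {H : Type v} [Group H] [TopologicalSpace H] [IsTopologicalGroup H]

omit [IsTopologicalGroup H] in
/-- **Greenberg 2010 (8): injectivity of restriction on `θ`-torsion.** Let `ι : H →ₜ* G`, suppose
`X` has no non-zero `ι(H)`-invariant ("`H⁰(K_η, T*) = 0`") and `θ` acts injectively on `X`
("`T*` torsion-free"). If `θ • φ(g) = g • t − t` (a `θ`-torsion class) and the restricted cocycle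
`φ ∘ ι` is principal, then `[φ] = 0`: indeed `ι h • (t − θu) = t − θu`, so `t = θu` and
`φ(g) = g • u − u`. [cite: Greenberg2010, §2.1 p. 8 L1–10, (8); §2.3 p. 13 L32–34 (proof of Prop. 2.3.2)] -/
theorem oneCocycleClass_eq_zero_of_smul_eq_zero_of_restrict (ι : H →ₜ* G) (θ : R)
    (hθ : ∀ x : X, θ • x = 0 → x = 0)
    (hH0 : ∀ x : X, (∀ h : H, X.ρ (ι h) x = x) → x = 0)
    (φ : contOneCocycles X) {t : X} (ht : ∀ g : G, θ • φ.1 g = X.ρ g t - t)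
    {u : X} (hu : ∀ h : H, φ.1 (ι h) = X.ρ (ι h) u - u) : oneCocycleClass X φ = 0 := by
  -- `t - θ • u` is `ι(H)`-invariant, hence zero
  have hinv : ∀ h : H, X.ρ (ι h) (t - θ • u) = t - θ • u := fun h => by
    have h1 := ht (ι h)
    rw [hu h, smul_sub, ← map_smul] at h1
    -- h1 : θ • (ρ u) - θ • u = ρ t - t, with θ • ρ u = ρ (θ • u)
    rw [map_sub]
    have : X.ρ (ι h) t - t = X.ρ (ι h) (θ • u) - θ • u := h1.symm
    -- rearrange
    have h2 : X.ρ (ι h) t - X.ρ (ι h) (θ • u) = t - θ • u := by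
      have := sub_eq_sub_iff_sub_eq_sub.mp this
      exact this
    exact h2
  have ht0 : t = θ • u := sub_eq_zero.1 (hH0 _ hinv)
  refine oneCocycleClass_eq_zero_of_smul_apply_eq_sub_smul X θ hθ φ u fun g => ?_
  rw [ht g, ht0]

omit [IsTopologicalGroup G] [IsTopologicalGroup H] in
/-- The restricted representation acts through `ι`: `(res ι X).ρ h = X.ρ (ι h)`.
[cite: Greenberg2010, §2.1 p. 8 (8)] -/
theorem res_ρ_apply (ι : H →ₜ* G) (h : H) (x : X) :
    (res (ι : H →* G) X).ρ h x = X.ρ (ι h) x := rfl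

/-- **(8) on classes**: with `ι : H →ₜ* G`, `X^{ι(H)} = 0` and `θ` acting injectively on `X`, a class
`y ∈ H¹_cont(G, X)` with `θ • y = 0` whose restriction `H¹(ι)(y) ∈ H¹_cont(H, X)` vanishes is zero —
"the map `H¹(K, T*)_{Λ-tors} → H¹(K_η, T*)_{Λ-tors}` is injective".
[cite: Greenberg2010, §2.1 p. 8 L8–10, (8); §2.3 p. 13 L32–34 (proof of Prop. 2.3.2)] -/
theorem eq_zero_of_smul_eq_zero_of_map_eq_zero (ι : H →ₜ* G) (θ : R)
    (hθ : ∀ x : X, θ • x = 0 → x = 0)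
    (hH0 : ∀ x : X, (∀ h : H, X.ρ (ι h) x = x) → x = 0)
    (y : continuousCohomology 1 X) (hy : θ • y = 0)
    (hres : ContinuousCohomology.map ι (𝟙 (res (ι : H →* G) X)) 1 y = 0) : y = 0 := by
  obtain ⟨φ, rfl⟩ := oneCocycleClass_surjective X y
  obtain ⟨t, ht⟩ := exists_smul_apply_eq_sub_of_smul_oneCocycleClass_eq_zero X θ φ hy
  rw [map_oneCocycleClass, oneCocycleClass_eq_zero_iff] at hres
  obtain ⟨u, hu⟩ := hres
  refine oneCocycleClass_eq_zero_of_smul_eq_zero_of_restrict X ι θ hθ hH0 φ ht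
    (u := u) fun h => ?_
  have h1 := hu h
  rw [contOneCocycles.pullback_apply] at h1
  change φ.1 (ι h) = X.ρ (ι h) u - u at h1
  exact h1

/-- **Torsion-submodule form of (8)**: for a domain of scalars acting injectively through every
nonzero `θ` (`X` torsion-free), the restriction map is injective on the `R`-torsion submodule of
`H¹_cont(G, X)` as soon as `X^{ι(H)} = 0`. [cite: Greenberg2010, §2.1 p. 8 L8–10, (8)] -/
theorem eq_zero_of_mem_torsion_of_map_eq_zero (ι : H →ₜ* G)
    (hθ : ∀ θ : R, θ ≠ 0 → ∀ x : X, θ • x = 0 → x = 0)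
    (hH0 : ∀ x : X, (∀ h : H, X.ρ (ι h) x = x) → x = 0)
    (y : continuousCohomology 1 X) (hy : ∃ θ : R, θ ≠ 0 ∧ θ • y = 0)
    (hres : ContinuousCohomology.map ι (𝟙 (res (ι : H →* G) X)) 1 y = 0) : y = 0 := by
  obtain ⟨θ, hθ0, hθy⟩ := hy
  exact eq_zero_of_smul_eq_zero_of_map_eq_zero X ι θ (hθ θ hθ0) hH0 y hθy hres

end Literature.NumberTheory.GaloisRepresentations

end
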